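import Summits.CriticalPhenomena.PercolationContinuityZ3.Theorems.PercNonProliferationSubpolynomialBlockingStubSixSlab
import Summits.CriticalPhenomena.PercolationContinuityZ3.Theorems.PercNonProliferationSubpolynomialBlockingStubTiling
import Summits.CriticalPhenomena.PercolationContinuityZ3.Theorems.PercNonProliferationSubpolynomialBlockingStubUpperSeedSandwich
import HarnessLib

/-!
# Crux `PercNonProliferation.SubpolynomialBlocking` (stmt-CriticalPhenomena-4446), line `cross-sandwich-flat-seal` — stub `stub_cruxIffSeedSubpoly`

Helper file for the crux skeleton `Cruxes/SubpolynomialBlocking/Lines/cross_sandwich_flat_seal.lean`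
(lead prover-line-stmt-CriticalPhenomena-4446-0). Proves exactly the registered stub signature
`stub_cruxIffSeedSubpoly`; lands with `--supports stmt-CriticalPhenomena-4446`.

## The statement (CERTIFIED REDUCTION OF THE CRUX TO ONE FLAT BOX)

For every aspect parameter `k ≥ 2` the crux — the critical annulus-blocking probability
`u_n = P_{p_c}(Λ_n ↮ ∂ⁱⁿΛ_{2n} in Λ_{2n})` is `≥ n^{-s}` eventually for every `s > 0` — is EQUIVALENT to
the same sub-polynomial lower bound for ONE flat-box sealing probability
`seed_k(n) = P_{p_c}(no open path inside [0,n] × [0, n+⌊n/k⌋]² from the face {x₀ = 0} to the face {x₀ = n})`.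

## The argument

`⇒`: `n^{-6s} ≤ u_n ≤ seed_k(n)⁶` for `n ≥ 3` (the landed upper seed sandwich `stub_upperSeedSandwich`, which needs
`k ≥ 2`), sixth roots. `⇐`: `u_n ≥ V_n⁶` (`stub_sixSlab`) and `V_n ≥ seed_k(n)^K` for `n ≥ N` (`stub_tiling`), so
`u_n ≥ seed_k(n)^{6K}`; a sub-polynomial sequence stays sub-polynomial under a FIXED power (`n^{-s} ≤ (n^{-s/(6K)})^{6K}`).
The crux is read through `Negative.crux_iff` / `Negative.subpolynomialBlockingAt_iff` (both `Iff.rfl`).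
-/

noncomputable section

namespace Summit.CriticalPhenomena.PercolationContinuityZ3.Theorems.SubpolynomialBlocking

open MeasureTheory Filter Topology
open Literature.Probability.Percolation Literature.Probability.LatticeModels
open Summit.CriticalPhenomena.PercolationContinuityZ3.Theorems.SubpolynomialBlocking.Negative

namespace StubCruxIffSeedSubpoly

/-- Real-analysis glue: for `s` real, a fixed exponent `M ≥ 1` and `n : ℕ`, `n^{-s} = (n^{-s/M})^M`. -/
theorem rpow_neg_eq_pow (s : ℝ) {M : ℕ} (hM : 1 ≤ M) (n : ℕ) :
    (n : ℝ) ^ (-s) = ((n : ℝ) ^ (-(s / M))) ^ M := by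
  have hn0 : (0 : ℝ) ≤ n := Nat.cast_nonneg n
  have hM0 : (M : ℝ) ≠ 0 := by exact_mod_cast (show M ≠ 0 by omega)
  rw [← Real.rpow_natCast, ← Real.rpow_mul hn0]
  congr 1
  field_simp

/-- If `a_n ≥ n^{-t}` eventually for every `t > 0` and `b_n ≥ a_n ^ M` eventually (`M ≥ 1`), then
`b_n ≥ n^{-s}` eventually for every `s > 0`. -/
theorem subpoly_of_pow_le {a b : ℕ → ℝ} {M : ℕ} (hM : 1 ≤ M)
    (ha : ∀ t : ℝ, 0 < t → ∀ᶠ n : ℕ in atTop, (n : ℝ) ^ (-t) ≤ a n)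
    (hab : ∀ᶠ n : ℕ in atTop, a n ^ M ≤ b n) :
    ∀ s : ℝ, 0 < s → ∀ᶠ n : ℕ in atTop, (n : ℝ) ^ (-s) ≤ b n := by
  intro s hs
  have hMr : (0 : ℝ) < M := by exact_mod_cast (show 0 < M by omega)
  filter_upwards [ha (s / M) (div_pos hs hMr), hab] with n h1 h2
  have h0 : (0 : ℝ) ≤ (n : ℝ) ^ (-(s / M)) := Real.rpow_nonneg (Nat.cast_nonneg n) _
  calc (n : ℝ) ^ (-s) = ((n : ℝ) ^ (-(s / M))) ^ M := rpow_neg_eq_pow s hM n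
    _ ≤ a n ^ M := pow_le_pow_left₀ h0 h1 M
    _ ≤ b n := h2

/-- If `a_n ≥ n^{-t}` eventually for every `t > 0` and `a_n ≤ b_n ^ M` eventually (`M ≥ 1`, `b_n ≥ 0`), then
`b_n ≥ n^{-s}` eventually for every `s > 0` (`M`-th roots). -/
theorem subpoly_of_le_pow {a b : ℕ → ℝ} {M : ℕ} (hM : 1 ≤ M) (hb0 : ∀ n, 0 ≤ b n)
    (ha : ∀ t : ℝ, 0 < t → ∀ᶠ n : ℕ in atTop, (n : ℝ) ^ (-t) ≤ a n)
    (hab : ∀ᶠ n : ℕ in atTop, a n ≤ b n ^ M) :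
    ∀ s : ℝ, 0 < s → ∀ᶠ n : ℕ in atTop, (n : ℝ) ^ (-s) ≤ b n := by
  intro s hs
  have hMpos : 0 < M := by omega
  have hMr : (0 : ℝ) < M := by exact_mod_cast hMpos
  filter_upwards [ha (M * s) (mul_pos hMr hs), hab] with n h1 h2
  have hn0 : (0 : ℝ) ≤ n := Nat.cast_nonneg n
  have key : ((n : ℝ) ^ (-s)) ^ M ≤ b n ^ M := by
    calc ((n : ℝ) ^ (-s)) ^ M = (n : ℝ) ^ (-(M * s)) := by
          rw [← Real.rpow_natCast, ← Real.rpow_mul hn0]; ring_nf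
      _ ≤ a n := h1
      _ ≤ b n ^ M := h2
  exact le_of_pow_le_pow_left₀ (Nat.pos_iff_ne_zero.mp hMpos) (hb0 n) key

end StubCruxIffSeedSubpoly

open StubCruxIffSeedSubpoly in
/-- **Registered stub `stub_cruxIffSeedSubpoly`** (crux stmt-CriticalPhenomena-4446, line `cross-sandwich-flat-seal`):
for every `k ≥ 2`, the crux `SubpolynomialBlocking` is EQUIVALENT to the sub-polynomial lower bound
`∀ s > 0, ∀ᶠ n, n^{-s} ≤ P_{p_c}([0,n] × [0,n+⌊n/k⌋]² sealed between {x₀ = 0} and {x₀ = n})` for the single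
flat seed of aspect ratio `1 + 1/k` (`⇒` by `stub_upperSeedSandwich`; `⇐` by `stub_sixSlab` and `stub_tiling`). -/
theorem stub_cruxIffSeedSubpoly :
    ∀ k : ℕ, 2 ≤ k →
      (Summit.CriticalPhenomena.PercolationContinuityZ3.Theses.PercNonProliferation.SubpolynomialBlocking ↔
        ∀ s : ℝ, 0 < s → ∀ᶠ n : ℕ in atTop,
          (n : ℝ) ^ (-s) ≤
            (bondPercolation (zdGraph 3) (criticalProbI 3)).real
              (openCrossing (Set.Icc (0 : Site 3) ![(n : ℤ), (n : ℤ) + (n / k : ℕ), (n : ℤ) + (n / k : ℕ)])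
                {x | x ∈ Set.Icc (0 : Site 3) ![(n : ℤ), (n : ℤ) + (n / k : ℕ), (n : ℤ) + (n / k : ℕ)] ∧ x 0 = 0}
                {y | y ∈ Set.Icc (0 : Site 3) ![(n : ℤ), (n : ℤ) + (n / k : ℕ), (n : ℤ) + (n / k : ℕ)] ∧
                  y 0 = (n : ℤ)})ᶜ) := by
  intro k hk
  have hk1 : 1 ≤ k := le_trans (by norm_num) hk
  constructor
  · -- `⇒`: sixth roots of `n^{-6s} ≤ u_n ≤ seed_k(n)⁶`
    intro h
    refine subpoly_of_le_pow (M := 6) (by norm_num) (fun n => measureReal_nonneg) (crux_iff.mp h) ?_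
    filter_upwards [eventually_ge_atTop 3] with n hn
    exact stub_upperSeedSandwich k n hk hn
  · -- `⇐`: `seed^K ≤ V` (tiling), `V⁶ ≤ u` (six slabs)
    intro h
    obtain ⟨K, N, hKN⟩ := stub_tiling k hk1
    refine crux_iff.mpr ?_
    -- `V_n` is sub-polynomial: use the power `K + 1 ≥ 1` (`seed^(K+1) ≤ seed^K` since `seed ≤ 1`)
    have hV : ∀ t : ℝ, 0 < t → ∀ᶠ n : ℕ in atTop, (n : ℝ) ^ (-t) ≤
        (bondPercolation (zdGraph 3) (criticalProbI 3)).real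
          (openCrossing (Set.Icc (![(n : ℤ), -(2 * (n : ℤ)), -(2 * (n : ℤ))] : Site 3)
              ![2 * (n : ℤ), 2 * (n : ℤ), 2 * (n : ℤ)])
            {x | x ∈ Set.Icc (![(n : ℤ), -(2 * (n : ℤ)), -(2 * (n : ℤ))] : Site 3)
              ![2 * (n : ℤ), 2 * (n : ℤ), 2 * (n : ℤ)] ∧ x 0 = (n : ℤ)}
            {y | y ∈ Set.Icc (![(n : ℤ), -(2 * (n : ℤ)), -(2 * (n : ℤ))] : Site 3)
              ![2 * (n : ℤ), 2 * (n : ℤ), 2 * (n : ℤ)] ∧ y 0 = 2 * (n : ℤ)})ᶜ := by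
      refine subpoly_of_pow_le (M := K + 1) (by omega) h ?_
      filter_upwards [eventually_ge_atTop N] with n hn
      refine le_trans ?_ (hKN n hn)
      rw [pow_succ]
      exact mul_le_of_le_one_right (pow_nonneg measureReal_nonneg K) measureReal_le_one
    refine subpoly_of_pow_le (M := 6) (by norm_num) hV ?_
    filter_upwards [eventually_ge_atTop 1] with n hn
    exact stub_sixSlab n hn

end Summit.CriticalPhenomena.PercolationContinuityZ3.Theorems.SubpolynomialBlocking

end
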